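import Literature.Analysis.FluidPDE.EulerTorusContinuation
import Literature.Analysis.FluidPDE.FractionalNSReynolds
import Literature.Analysis.FluidPDE.FracTransportHolderEstimate
import Literature.Analysis.FluidPDE.FracLaplacianSpaceTime
import Literature.Analysis.FunctionSpaces.TorusFourierSeries
import Literature.Analysis.FunctionSpaces.TorusVectorParseval
import Literature.Analysis.FunctionSpaces.ContDiffHolderAlgebra
import Literature.Analysis.FunctionSpaces.ContDiffHolderLeibniz
import HarnessLib

/-!
# Continuation of smooth solutions of the fractional Navier–Stokes equations on the flat torus:
# forward uniqueness, gluing and restarting (proofs)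

Analysis/FluidPDE support file (everything proved; no definitions, no named facts). The
elementary half of the classical continuation argument (Majda–Bertozzi 2002, §3.2.3, proof of
Thm. 3.5 / Cor. 3.2: restart the local solution, identify it with the old one on the overlap by
uniqueness, glue) for smooth solutions of the fractional Navier–Stokes(–Reynolds) system
`∂ₜv + (v·∇)v + ∇p + ν(-Δ)^θ v = div R`, `div v = 0` on `T^d` in the vocabulary of
`Torus.IsFracNSReynoldsOn` (`FractionalNSReynolds.lean`), the fractional twin of
`EulerTorusUniqueness.lean` / `EulerTorusContinuation.lean`:

* `Torus.IsFracNSReynoldsOn.glue` — two solutions on overlapping compact intervals which agree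
  on the overlap glue to one solution (joint smoothness and one-sided time derivatives are local
  in time: `Torus.isSmoothSpaceTimeOn_glue`, `Torus.timeDerivWithin_glue_left/right`);
* `Torus.IsFracNSReynoldsOn.unique_forward` — **forward uniqueness** of smooth solutions with
  the same stress from a common value at the left endpoint (`ν ≥ 0`, `θ ≥ 0`): the energy
  `E = ∫|u₁ - u₂|²` satisfies `E' ≤ 2‖∇u₂‖_∞ E - 2ν∫⟪(-Δ)^θ w, w⟫ ≤ 2‖∇u₂‖_∞ E` within `[a, b]`
  (the dissipation pairing is `∑ₖ (4π²|k|²)^θ |ŵ(k)|² ≥ 0`), so `E ≡ 0` forward from `E(a) = 0`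
  by Grönwall; zero-mean pressures then coincide (equal gradients);
* `Torus.sum_weight_four_sq_norm_mFourierCoeff_le` — the `H⁴`-type weight of the Fourier
  coefficients is controlled by the `C^{4,r}` norm:
  `∑_{k∈S} (1+|k|²)⁴ |â(k)|² ≤ (C_d B)²` when `‖a‖_{C^{4,r}} ≤ B` (Parseval for `(1 - Δ/4π²)²a`);
* `Torus.IsFracNSReynoldsOn.step_forward` / `extend_forward` — one restart step and the
  induction: from a short-time existence statement for data satisfying a predicate `P` (a
  solution on `[0, h]` with zero-mean pressure), a solution on `[0, b]` all of whose slices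
  satisfy `P` extends to `[0, b + h/2]` (restart from `u(b - h/2)` — forward in time, as befits a
  dissipative system —, translate, identify on `[b - h/2, b]` by forward uniqueness, glue), and
  if `P` holds a priori along all solutions through the datum on subintervals of `[0, T]`, the
  solution reaches `T` in finitely many steps.

The consumer is the local existence theorem for the fractional Navier–Stokes equations with
life span `c/‖u₀‖_{1+α}` (De Rosa 2019, Thm. 3.4 with Prop. 3.5; `FracNSLocalExistence.lean`),
which feeds De Rosa's gluing stage (`DeRosa.gluingStage_of_localExistence₀_of_commutatorCZBound`).

## References

* A. J. Majda, A. L. Bertozzi, *Vorticity and Incompressible Flow*, CUP 2002, §3.1.1 Cor. 3.1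
  (uniqueness by the basic energy estimate) and §3.2.3, proof of Thm. 3.5 / Cor. 3.2
  (continuation by restarting and uniqueness). [`MajdaBertozziCUP2002`]
* L. De Rosa, *Infinitely many Leray–Hopf solutions for the fractional Navier–Stokes equations*,
  Comm. PDE 44 (2019) = arXiv:1801.10235, §3.2 (Thm. 3.4, Prop. 3.5: "there exists a unique
  solution"). [`Derosa2018`]
-/

open MeasureTheory Set Filter
open scoped NNReal ENNReal ContDiff Topology InnerProductSpace

noncomputable section

namespace Literature.Analysis.FluidPDE

namespace Torus

variable {d : Type*} [Fintype d] [DecidableEq d]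

/-! ## Gluing fractional Navier–Stokes–Reynolds solutions on overlapping compact intervals -/

section Glue

variable {θ ν a b a' b' m : ℝ} {u₁ u₂ : ℝ → UnitAddTorus d → EuclideanSpace ℝ d}
  {p₁ p₂ : ℝ → UnitAddTorus d → ℝ} {R : ℝ → UnitAddTorus d → d → EuclideanSpace ℝ d}

/-- **Gluing fractional Navier–Stokes–Reynolds solutions.** Let `(u₁, p₁, R)` solve the system
on `[a, b] × T^d` and `(u₂, p₂, R)` on `[a', b'] × T^d` (same exponent, viscosity and stress),
with `a ≤ a' < m < b ≤ b'`, and suppose the two solutions agree (velocity and pressure) on the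
overlap `[a', b]`. Then the fields equal to `(u₁, p₁)` for `t ≤ m` and to `(u₂, p₂)` for `t > m`
solve the system on `[a, b'] × T^d` (twin of `Torus.IsEulerReynoldsOn.glue`: joint smoothness is
local in time, and the one-sided time derivatives within `[a, b']` are those within the pieces;
the other terms of the momentum equation only involve the time slice). [folklore] -/
theorem IsFracNSReynoldsOn.glue (h₁ : IsFracNSReynoldsOn (Icc a b) θ ν u₁ p₁ R)
    (h₂ : IsFracNSReynoldsOn (Icc a' b') θ ν u₂ p₂ R) (haa' : a ≤ a') (ham : a' < m) (hmb : m < b)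
    (hbb' : b ≤ b') (heq : ∀ t ∈ Icc a' b, u₁ t = u₂ t ∧ p₁ t = p₂ t) :
    IsFracNSReynoldsOn (Icc a b') θ ν (fun t => if t ≤ m then u₁ t else u₂ t)
      (fun t => if t ≤ m then p₁ t else p₂ t) R := by
  have ha'b : a' < b := ham.trans hmb
  -- the glued fields agree with the pieces on the two relatively open parts
  have hU₁ : ∀ t ∈ Icc a b', t < b → (if t ≤ m then u₁ t else u₂ t) = u₁ t := by
    intro t ht htb
    by_cases htm : t ≤ m
    · rw [if_pos htm]
    · rw [if_neg htm, (heq t ⟨(ham.trans (not_le.1 htm)).le, htb.le⟩).1]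
  have hU₂ : ∀ t ∈ Icc a b', a' < t → (if t ≤ m then u₁ t else u₂ t) = u₂ t := by
    intro t ht hta
    by_cases htm : t ≤ m
    · rw [if_pos htm, (heq t ⟨hta.le, htm.trans hmb.le⟩).1]
    · rw [if_neg htm]
  have hP₁ : ∀ t ∈ Icc a b', t < b → (if t ≤ m then p₁ t else p₂ t) = p₁ t := by
    intro t ht htb
    by_cases htm : t ≤ m
    · rw [if_pos htm]
    · rw [if_neg htm, (heq t ⟨(ham.trans (not_le.1 htm)).le, htb.le⟩).2]
  have hP₂ : ∀ t ∈ Icc a b', a' < t → (if t ≤ m then p₁ t else p₂ t) = p₂ t := by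
    intro t ht hta
    by_cases htm : t ≤ m
    · rw [if_pos htm, (heq t ⟨hta.le, htm.trans hmb.le⟩).2]
    · rw [if_neg htm]
  -- membership of the two halves in the pieces
  have hmem₁ : ∀ t ∈ Icc a b', t ≤ m → t ∈ Icc a b := fun t ht htm => ⟨ht.1, htm.trans hmb.le⟩
  have hmem₂ : ∀ t ∈ Icc a b', ¬t ≤ m → t ∈ Icc a' b' := fun t ht htm =>
    ⟨(ham.trans (not_le.1 htm)).le, ht.2⟩
  refine
    { smooth_velocity := isSmoothSpaceTimeOn_glue h₁.smooth_velocity h₂.smooth_velocity ha'b hU₁ hU₂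
      smooth_pressure := isSmoothSpaceTimeOn_glue h₁.smooth_pressure h₂.smooth_pressure ha'b hP₁ hP₂
      smooth_stress := isSmoothSpaceTimeOn_glue h₁.smooth_stress h₂.smooth_stress ha'b
        (fun _ _ _ => rfl) (fun _ _ _ => rfl)
      momentum := ?_
      divFree := ?_
      symm := ?_ }
  · intro t ht x
    by_cases htb : t < b
    · rw [timeDerivWithin_glue_left hbb' hU₁ ht htb x]
      simp only [hU₁ t ht htb, hP₁ t ht htb]
      exact h₁.momentum t ⟨ht.1, htb.le⟩ x
    · have hta : a' < t := ha'b.trans_le (not_lt.1 htb)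
      rw [timeDerivWithin_glue_right haa' hU₂ ht hta x]
      simp only [hU₂ t ht hta, hP₂ t ht hta]
      exact h₂.momentum t ⟨hta.le, ht.2⟩ x
  · intro t ht
    by_cases htm : t ≤ m
    · simp only [if_pos htm]; exact h₁.divFree t (hmem₁ t ht htm)
    · simp only [if_neg htm]; exact h₂.divFree t (hmem₂ t ht htm)
  · intro t ht
    by_cases htm : t ≤ m
    · exact h₁.symm t (hmem₁ t ht htm)
    · exact h₂.symm t (hmem₂ t ht htm)

/-- **Time translation of fractional Navier–Stokes–Reynolds triples** (any dimension): the
system is autonomous, so if `(v, p, R)` solves it on `S × T^d` then `t ↦ (v, p, R)(t - c)`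
solves it on `((· - c)⁻¹' S) × T^d` (cf. `Torus.IsEulerReynoldsOn.timeTranslate`, and the
three-dimensional `Torus.IsFracNSReynoldsOn.timeTranslate` of `DeRosaGluingPotential.lean`).
[folklore] -/
theorem IsFracNSReynoldsOn.translate {S : Set ℝ} (h : IsFracNSReynoldsOn S θ ν u₁ p₁ R) (c : ℝ) :
    IsFracNSReynoldsOn ((fun s : ℝ => s - c) ⁻¹' S) θ ν (fun t => u₁ (t - c)) (fun t => p₁ (t - c))
      (fun t => R (t - c)) where
  smooth_velocity := h.smooth_velocity.comp_sub_time c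
  smooth_pressure := h.smooth_pressure.comp_sub_time c
  smooth_stress := h.smooth_stress.comp_sub_time c
  momentum t ht x := by
    rw [timeDerivWithin_comp_sub_right]
    exact h.momentum (t - c) ht x
  divFree t ht := h.divFree (t - c) ht
  symm t ht := h.symm (t - c) ht

end Glue

/-! ## Forward uniqueness by the energy argument -/

section Unique

variable {θ ν a b : ℝ} {u₁ u₂ : ℝ → UnitAddTorus d → EuclideanSpace ℝ d}
  {p₁ p₂ : ℝ → UnitAddTorus d → ℝ} {R : ℝ → UnitAddTorus d → d → EuclideanSpace ℝ d}

omit [DecidableEq d] in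
/-- **The dissipation pairing is nonnegative**: `∫⟪v, (-Δ)^θ v⟫ = ∑ₖ (4π²|k|²)^θ |v̂(k)|² ≥ 0`
for smooth `v` and `θ ≥ 0` (Parseval form of the pairing, `Torus.integral_inner_fracLaplacian_eq_tsum`).
[folklore] -/
theorem integral_inner_self_fracLaplacian_nonneg (hθ : 0 ≤ θ) {v : UnitAddTorus d → EuclideanSpace ℝ d}
    (hv : FunctionSpaces.Torus.IsSmooth v) : 0 ≤ ∫ x, ⟪v x, fracLaplacian θ v x⟫_ℝ := by
  classical
  rw [integral_inner_fracLaplacian_eq_tsum hθ hv hv.continuous]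
  refine tsum_nonneg fun k => mul_nonneg (fracSymbol_nonneg θ k) ?_
  simpa using inner_self_nonneg (𝕜 := ℂ)
    (x := UnitAddTorus.mFourierCoeff (FunctionSpaces.EuclideanSpace.complexify ∘ v) k)

/-- The one-sided time derivative of the difference of the velocities of two fractional
Navier–Stokes–Reynolds solutions on `[a, b]`, `a < b`, is the difference of their time
derivatives. [folklore] -/
theorem IsFracNSReynoldsOn.timeDerivWithin_sub (h₁ : IsFracNSReynoldsOn (Icc a b) θ ν u₁ p₁ R)
    (h₂ : IsFracNSReynoldsOn (Icc a b) θ ν u₂ p₂ R) (hab : a < b) {t : ℝ} (ht : t ∈ Icc a b)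
    (x : UnitAddTorus d) :
    FunctionSpaces.Torus.timeDerivWithin (Icc a b) (fun s y => u₁ s y - u₂ s y) t x =
      FunctionSpaces.Torus.timeDerivWithin (Icc a b) u₁ t x -
        FunctionSpaces.Torus.timeDerivWithin (Icc a b) u₂ t x :=
  ((h₁.smooth_velocity.hasDerivWithinAt_slice ht x).sub
    (h₂.smooth_velocity.hasDerivWithinAt_slice ht x)).derivWithin (uniqueDiffOn_Icc hab t ht)

/-- **The equation for the difference.** For two fractional Navier–Stokes–Reynolds solutions
with the same exponent `θ ≥ 0`, viscosity and stress, `w = u₁ - u₂` satisfies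
`∂ₜw = -((u₁·∇)w + (w·∇)u₂) - ∇(p₁ - p₂) - ν(-Δ)^θ w` pointwise on `[a, b] × T^d`. [folklore] -/
theorem IsFracNSReynoldsOn.timeDerivWithin_sub_eq (h₁ : IsFracNSReynoldsOn (Icc a b) θ ν u₁ p₁ R)
    (h₂ : IsFracNSReynoldsOn (Icc a b) θ ν u₂ p₂ R) (hθ : 0 ≤ θ) (hab : a < b) {t : ℝ}
    (ht : t ∈ Icc a b) (x : UnitAddTorus d) :
    FunctionSpaces.Torus.timeDerivWithin (Icc a b) (fun s y => u₁ s y - u₂ s y) t x =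
      -(FunctionSpaces.Torus.convect (u₁ t) (fun y => u₁ t y - u₂ t y) x +
          FunctionSpaces.Torus.convect (fun y => u₁ t y - u₂ t y) (u₂ t) x) -
        FunctionSpaces.Torus.gradient (fun y => p₁ t y - p₂ t y) x -
        ν • fracLaplacian θ (fun y => u₁ t y - u₂ t y) x := by
  have hm₁ := h₁.momentum t ht x
  have hm₂ := h₂.momentum t ht x
  have hS₁ : FunctionSpaces.Torus.IsSmooth (u₁ t) := h₁.smooth_velocity.isSmooth_slice ht
  have hS₂ : FunctionSpaces.Torus.IsSmooth (u₂ t) := h₂.smooth_velocity.isSmooth_slice ht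
  have hs₁ : FunctionSpaces.Torus.IsContDiff 1 (u₁ t) := hS₁.isContDiff (by simp)
  have hs₂ : FunctionSpaces.Torus.IsContDiff 1 (u₂ t) := hS₂.isContDiff (by simp)
  have hq₁ : FunctionSpaces.Torus.IsContDiff 1 (p₁ t) :=
    (h₁.smooth_pressure.isSmooth_slice ht).isContDiff (by simp)
  have hq₂ : FunctionSpaces.Torus.IsContDiff 1 (p₂ t) :=
    (h₂.smooth_pressure.isSmooth_slice ht).isContDiff (by simp)
  -- the convective terms: `(u₁·∇)u₁ - (u₂·∇)u₂ = (u₁·∇)w + (w·∇)u₂`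
  have hconv : FunctionSpaces.Torus.convect (u₁ t) (u₁ t) x - FunctionSpaces.Torus.convect (u₂ t) (u₂ t) x =
      FunctionSpaces.Torus.convect (u₁ t) (fun y => u₁ t y - u₂ t y) x +
        FunctionSpaces.Torus.convect (fun y => u₁ t y - u₂ t y) (u₂ t) x := by
    have hw : (fun y => u₁ t y - u₂ t y) = u₁ t - u₂ t := rfl
    simp only [FunctionSpaces.Torus.convect, hw, FunctionSpaces.Torus.fderiv_sub hs₁ hs₂,
      FunLike.coe_sub, Pi.sub_apply, map_sub]
    abel
  have hgrad : FunctionSpaces.Torus.gradient (fun y => p₁ t y - p₂ t y) x =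
      FunctionSpaces.Torus.gradient (p₁ t) x - FunctionSpaces.Torus.gradient (p₂ t) x := by
    have hq : (fun y => p₁ t y - p₂ t y) = p₁ t - p₂ t := rfl
    rw [hq, FunctionSpaces.Torus.gradient_sub hq₁ hq₂]
  have hfrac : fracLaplacian θ (fun y => u₁ t y - u₂ t y) x =
      fracLaplacian θ (u₁ t) x - fracLaplacian θ (u₂ t) x := by
    rw [fracLaplacian_sub hθ hS₁ hS₂]
  rw [h₁.timeDerivWithin_sub h₂ hab ht x, hgrad, hfrac, ← hconv, smul_sub]
  -- now pure algebra from the two momentum equations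
  have e₁ := eq_sub_of_add_eq (eq_sub_of_add_eq (eq_sub_of_add_eq hm₁))
  have e₂ := eq_sub_of_add_eq (eq_sub_of_add_eq (eq_sub_of_add_eq hm₂))
  rw [e₁, e₂]
  abel

/-- **The energy inequality for the difference, forward in time.** With `w = u₁ - u₂`, `L` a
bound for the first spatial derivatives of `u₂` on `[a, b] × T^d`, `θ ≥ 0` and `ν ≥ 0`, the
energy `E(t) = ∫⟪w, w⟫` has one-sided derivative
`E'(t) = -2∫⟪(w·∇)u₂, w⟫ - 2ν∫⟪(-Δ)^θ w, w⟫ ≤ 2L' E(t)` within `[a, b]` (`∫⟪(u₁·∇)w, w⟫ = 0 = ∫⟪∇q, w⟫`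
and the dissipation pairing is nonnegative). Rendered: there is `K ≥ 0` and a function `E'`
with `HasDerivWithinAt E (E' t) [a, b] t` and `E' t ≤ K · E t` for all `t ∈ [a, b]`. [folklore] -/
theorem IsFracNSReynoldsOn.exists_energy_deriv_sub_le (h₁ : IsFracNSReynoldsOn (Icc a b) θ ν u₁ p₁ R)
    (h₂ : IsFracNSReynoldsOn (Icc a b) θ ν u₂ p₂ R) (hθ : 0 ≤ θ) (hν : 0 ≤ ν) (hab : a < b) :
    ∃ (K : ℝ) (E' : ℝ → ℝ), 0 ≤ K ∧ ∀ t ∈ Icc a b,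
      HasDerivWithinAt (fun s => ∫ x, ⟪u₁ s x - u₂ s x, u₁ s x - u₂ s x⟫_ℝ) (E' t) (Icc a b) t ∧
        E' t ≤ K * ∫ x, ⟪u₁ t x - u₂ t x, u₁ t x - u₂ t x⟫_ℝ := by
  classical
  have hU : UniqueDiffOn ℝ (Icc a b) := uniqueDiffOn_Icc hab
  set w : ℝ → UnitAddTorus d → EuclideanSpace ℝ d := fun s y => u₁ s y - u₂ s y with hw_def
  have hw : FunctionSpaces.Torus.IsSmoothSpaceTimeOn (Icc a b) w :=
    h₁.smooth_velocity.sub h₂.smooth_velocity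
  -- uniform bounds for the first derivatives of `u₂`
  have hbd : ∀ i : d, ∃ C : ℝ, ∀ t ∈ Icc a b, ∀ x,
      ‖FunctionSpaces.Torus.partialDeriv i (u₂ t) x‖ ≤ C := fun i =>
    (h₂.smooth_velocity.partialDeriv hU i).exists_norm_le_of_isCompact isCompact_Icc subset_rfl
  choose C hC using hbd
  set L : ℝ := ∑ i, |C i| with hL_def
  have hL0 : 0 ≤ L := Finset.sum_nonneg fun i _ => abs_nonneg _
  -- the derivative of the energy
  set E' : ℝ → ℝ := fun t =>
    ∫ x, FunctionSpaces.Torus.timeDerivWithin (Icc a b) (fun s y => ⟪w s y, w s y⟫_ℝ) t x with hE'_def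
  refine ⟨2 * L, E', by positivity, fun t ht => ⟨?_, ?_⟩⟩
  · exact (hw.inner hw).hasDerivWithinAt_integral (convex_Icc a b) ht
  · -- identify `E' t = -2 ∫ ⟪(w·∇)u₂, w⟫ - 2ν ∫⟪w, (-Δ)^θ w⟫`
    have hwt : FunctionSpaces.Torus.IsSmooth (w t) := hw.isSmooth_slice ht
    have hu₁t : FunctionSpaces.Torus.IsSmooth (u₁ t) := h₁.smooth_velocity.isSmooth_slice ht
    have hu₂t : FunctionSpaces.Torus.IsSmooth (u₂ t) := h₂.smooth_velocity.isSmooth_slice ht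
    have hqt : FunctionSpaces.Torus.IsSmooth (fun y => p₁ t y - p₂ t y) :=
      (h₁.smooth_pressure.isSmooth_slice ht).sub (h₂.smooth_pressure.isSmooth_slice ht)
    have hFt : FunctionSpaces.Torus.IsSmooth (fracLaplacian θ (w t)) := hwt.fracLaplacian hθ
    have hdivw : FunctionSpaces.Torus.IsDivFree (w t) := by
      intro x
      have hw' : w t = u₁ t - u₂ t := rfl
      rw [hw', FunctionSpaces.Torus.divergence_sub (hu₁t.isContDiff (by simp)) (hu₂t.isContDiff (by simp)),
        h₁.divFree t ht x, h₂.divFree t ht x, sub_zero]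
    have hpt : ∀ x, FunctionSpaces.Torus.timeDerivWithin (Icc a b) (fun s y => ⟪w s y, w s y⟫_ℝ) t x =
        2 * ⟪FunctionSpaces.Torus.timeDerivWithin (Icc a b) w t x, w t x⟫_ℝ := by
      intro x
      rw [hw.timeDerivWithin_inner hw hU ht x, real_inner_comm (w t x)]
      ring
    have hderiv : ∀ x, FunctionSpaces.Torus.timeDerivWithin (Icc a b) w t x =
        -(FunctionSpaces.Torus.convect (u₁ t) (w t) x + FunctionSpaces.Torus.convect (w t) (u₂ t) x) -
          FunctionSpaces.Torus.gradient (fun y => p₁ t y - p₂ t y) x - ν • fracLaplacian θ (w t) x :=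
      fun x => h₁.timeDerivWithin_sub_eq h₂ hθ hab ht x
    have hE't : E' t = -2 * (∫ x, ⟪FunctionSpaces.Torus.convect (w t) (u₂ t) x, w t x⟫_ℝ) -
        2 * ν * ∫ x, ⟪w t x, fracLaplacian θ (w t) x⟫_ℝ := by
      simp only [hE'_def]
      simp_rw [hpt, hderiv]
      have hi1 : Integrable (fun x => ⟪FunctionSpaces.Torus.convect (u₁ t) (w t) x, w t x⟫_ℝ) volume :=
        ((hu₁t.convect hwt).inner hwt).integrable
      have hi2 : Integrable (fun x => ⟪FunctionSpaces.Torus.convect (w t) (u₂ t) x, w t x⟫_ℝ) volume :=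
        ((hwt.convect hu₂t).inner hwt).integrable
      have hi3 : Integrable
          (fun x => ⟪FunctionSpaces.Torus.gradient (fun y => p₁ t y - p₂ t y) x, w t x⟫_ℝ) volume :=
        (hqt.gradient.inner hwt).integrable
      have hi4 : Integrable (fun x => ⟪w t x, fracLaplacian θ (w t) x⟫_ℝ) volume :=
        (hwt.inner hFt).integrable
      have hi12 : Integrable (fun x => -(⟪FunctionSpaces.Torus.convect (u₁ t) (w t) x, w t x⟫_ℝ +
          ⟪FunctionSpaces.Torus.convect (w t) (u₂ t) x, w t x⟫_ℝ)) volume := (hi1.add hi2).neg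
      have hi123 : Integrable (fun x => -(⟪FunctionSpaces.Torus.convect (u₁ t) (w t) x, w t x⟫_ℝ +
          ⟪FunctionSpaces.Torus.convect (w t) (u₂ t) x, w t x⟫_ℝ) -
          ⟪FunctionSpaces.Torus.gradient (fun y => p₁ t y - p₂ t y) x, w t x⟫_ℝ) volume := hi12.sub hi3
      have hfr : ∀ x, ⟪ν • fracLaplacian θ (w t) x, w t x⟫_ℝ = ν * ⟪w t x, fracLaplacian θ (w t) x⟫_ℝ := by
        intro x
        rw [real_inner_smul_left, real_inner_comm]
      simp_rw [inner_sub_left, hfr, inner_neg_left, inner_add_left]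
      rw [integral_const_mul, integral_sub hi123 (hi4.const_mul ν), integral_sub hi12 hi3, integral_neg,
        integral_add hi1 hi2, integral_const_mul,
        integral_inner_convect_eq_zero hu₁t hwt (h₁.divFree t ht),
        FunctionSpaces.Torus.integral_inner_gradient_eq_zero_of_isDivFree hwt hqt hdivw]
      ring
    -- the bound `|⟪(w·∇)u₂, w⟫| ≤ L |w|²`
    have hpw : ∀ x, |⟪FunctionSpaces.Torus.convect (w t) (u₂ t) x, w t x⟫_ℝ| ≤ L * ⟪w t x, w t x⟫_ℝ := by
      intro x
      have hconv : FunctionSpaces.Torus.convect (w t) (u₂ t) x =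
          ∑ i, w t x i • FunctionSpaces.Torus.partialDeriv i (u₂ t) x :=
        FunctionSpaces.Torus.fderiv_apply_eq_sum_partialDeriv (hu₂t.isContDiff (by simp)) x (w t x)
      have hnorm : ‖FunctionSpaces.Torus.convect (w t) (u₂ t) x‖ ≤ L * ‖w t x‖ := by
        rw [hconv, hL_def, Finset.sum_mul]
        refine (norm_sum_le _ _).trans (Finset.sum_le_sum fun i _ => ?_)
        rw [norm_smul]
        calc ‖w t x i‖ * ‖FunctionSpaces.Torus.partialDeriv i (u₂ t) x‖
            ≤ ‖w t x‖ * |C i| := by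
              refine mul_le_mul (PiLp.norm_apply_le (w t x) i) ((hC i t ht x).trans (le_abs_self _))
                (norm_nonneg _) (norm_nonneg _)
          _ = |C i| * ‖w t x‖ := mul_comm _ _
      calc |⟪FunctionSpaces.Torus.convect (w t) (u₂ t) x, w t x⟫_ℝ|
          ≤ ‖FunctionSpaces.Torus.convect (w t) (u₂ t) x‖ * ‖w t x‖ := abs_real_inner_le_norm _ _
        _ ≤ L * ‖w t x‖ * ‖w t x‖ := by gcongr
        _ = L * ⟪w t x, w t x⟫_ℝ := by rw [real_inner_self_eq_norm_sq]; ring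
    have hint : |∫ x, ⟪FunctionSpaces.Torus.convect (w t) (u₂ t) x, w t x⟫_ℝ| ≤
        L * ∫ x, ⟪w t x, w t x⟫_ℝ := by
      rw [← integral_const_mul]
      refine (abs_integral_le_integral_abs).trans (integral_mono_of_nonneg ?_ ?_ ?_)
      · exact Eventually.of_forall fun x => abs_nonneg _
      · exact ((hwt.inner hwt).integrable).const_mul L
      · exact Eventually.of_forall hpw
    have hdiss : 0 ≤ ∫ x, ⟪w t x, fracLaplacian θ (w t) x⟫_ℝ := integral_inner_self_fracLaplacian_nonneg hθ hwt
    show E' t ≤ 2 * L * ∫ x, ⟪w t x, w t x⟫_ℝ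
    rw [hE't]
    have hab1 := (abs_le.1 hint).1
    have hνD := mul_nonneg hν hdiss
    nlinarith

/-- **Forward uniqueness of the velocity** for smooth fractional Navier–Stokes–Reynolds solutions
with the same stress agreeing at the left endpoint (`θ ≥ 0`, `ν ≥ 0`; energy argument and
Grönwall's inequality forward from `a`). [cite: MajdaBertozziCUP2002, Cor. 3.1] -/
theorem IsFracNSReynoldsOn.velocity_unique_forward (h₁ : IsFracNSReynoldsOn (Icc a b) θ ν u₁ p₁ R)
    (h₂ : IsFracNSReynoldsOn (Icc a b) θ ν u₂ p₂ R) (hθ : 0 ≤ θ) (hν : 0 ≤ ν) (hab : a < b)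
    (h0 : u₁ a = u₂ a) {t : ℝ} (ht : t ∈ Icc a b) : u₁ t = u₂ t := by
  classical
  obtain ⟨K, E', -, hE⟩ := h₁.exists_energy_deriv_sub_le h₂ hθ hν hab
  set E : ℝ → ℝ := fun s => ∫ x, ⟪u₁ s x - u₂ s x, u₁ s x - u₂ s x⟫_ℝ with hE_def
  have hEc : ContinuousOn E (Icc a b) := fun s hs => (hE s hs).1.continuousWithinAt
  have hE0 : E a = 0 := by simp [hE_def, h0]
  have hEnn : ∀ s, 0 ≤ E s := fun s => integral_nonneg fun x => real_inner_self_nonneg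
  -- `E` vanishes on `[a, b]` (Grönwall forward, one-sided derivative bound)
  have hder : ∀ x ∈ Ico a b, HasDerivWithinAt E (E' x) (Ici x) x := fun x hx =>
    ((hE x ⟨hx.1, hx.2.le⟩).1.mono (Icc_subset_Icc hx.1 le_rfl)).mono_of_mem_nhdsWithin
      (Icc_mem_nhdsGE hx.2)
  have hgr := le_gronwallBound_of_liminf_deriv_right_le (f := E) (f' := E') (δ := 0) (K := K) (ε := 0)
    hEc (fun x hx r hr => (hder x hx).liminf_right_slope_le hr) hE0.le
    (fun x hx => by rw [add_zero]; exact (hE x ⟨hx.1, hx.2.le⟩).2) t ht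
  rw [gronwallBound_ε0_δ0] at hgr
  have hEt : E t = 0 := le_antisymm hgr (hEnn t)
  have hwt : FunctionSpaces.Torus.IsSmooth (fun x => u₁ t x - u₂ t x) :=
    (h₁.smooth_velocity.sub h₂.smooth_velocity).isSmooth_slice ht
  have hzero : (fun x => ⟪u₁ t x - u₂ t x, u₁ t x - u₂ t x⟫_ℝ) = fun _ => (0 : ℝ) := by
    have hae := (integral_eq_zero_iff_of_nonneg (f := fun x => ⟪u₁ t x - u₂ t x, u₁ t x - u₂ t x⟫_ℝ)
      (fun x => real_inner_self_nonneg) (hwt.inner hwt).integrable).1 hEt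
    exact (Continuous.ae_eq_iff_eq volume (hwt.inner hwt).continuous continuous_const).1 hae
  funext x
  have hx := congrFun hzero x
  exact sub_eq_zero.1 (inner_self_eq_zero.1 hx)

/-- **Forward uniqueness of smooth fractional Navier–Stokes–Reynolds solutions with the same
stress** (Majda–Bertozzi 2002, Cor. 3.1, for the dissipative system and forward in time; De Rosa
2019, Prop. 3.5: "there exists a unique solution"): if `(u₁, p₁, R)` and `(u₂, p₂, R)` solve the
system on `[a, b] × T^d` (`θ ≥ 0`, `ν ≥ 0`, `a < b`) with `u₁(a) = u₂(a)` and both pressures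
have zero mean, then `u₁(t) = u₂(t)` and `p₁(t) = p₂(t)` for all `t ∈ [a, b]` (the pressure
gradients agree by the momentum equation once the velocities agree on `[a, b]`).
[cite: MajdaBertozziCUP2002, Cor. 3.1] -/
theorem IsFracNSReynoldsOn.unique_forward (h₁ : IsFracNSReynoldsOn (Icc a b) θ ν u₁ p₁ R)
    (h₂ : IsFracNSReynoldsOn (Icc a b) θ ν u₂ p₂ R) (hθ : 0 ≤ θ) (hν : 0 ≤ ν) (hab : a < b)
    (h0 : u₁ a = u₂ a) (hz₁ : ∀ t ∈ Icc a b, FunctionSpaces.Torus.HasZeroMean (p₁ t))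
    (hz₂ : ∀ t ∈ Icc a b, FunctionSpaces.Torus.HasZeroMean (p₂ t)) {t : ℝ} (ht : t ∈ Icc a b) :
    u₁ t = u₂ t ∧ p₁ t = p₂ t := by
  classical
  have hall : ∀ s ∈ Icc a b, u₁ s = u₂ s := fun s hs => h₁.velocity_unique_forward h₂ hθ hν hab h0 hs
  have hu : u₁ t = u₂ t := hall t ht
  refine ⟨hu, ?_⟩
  have hp₁ : FunctionSpaces.Torus.IsSmooth (p₁ t) := h₁.smooth_pressure.isSmooth_slice ht
  have hp₂ : FunctionSpaces.Torus.IsSmooth (p₂ t) := h₂.smooth_pressure.isSmooth_slice ht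
  have hgrad : ∀ x, FunctionSpaces.Torus.gradient (fun y => p₁ t y - p₂ t y) x = 0 := by
    intro x
    have hm₁ := h₁.momentum t ht x
    have hm₂ := h₂.momentum t ht x
    have hD : FunctionSpaces.Torus.timeDerivWithin (Icc a b) u₁ t x =
        FunctionSpaces.Torus.timeDerivWithin (Icc a b) u₂ t x := by
      simp only [FunctionSpaces.Torus.timeDerivWithin]
      exact derivWithin_congr (fun s hs => congrFun (hall s hs) x) (congrFun hu x)
    rw [hD, hu] at hm₁
    have hq : (fun y => p₁ t y - p₂ t y) = p₁ t - p₂ t := rfl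
    rw [hq, FunctionSpaces.Torus.gradient_sub (hp₁.isContDiff (by simp)) (hp₂.isContDiff (by simp)),
      sub_eq_zero]
    have h := hm₁.trans hm₂.symm
    exact add_left_cancel (add_right_cancel h)
  have hmean : FunctionSpaces.Torus.HasZeroMean (fun y => p₁ t y - p₂ t y) := by
    unfold FunctionSpaces.Torus.HasZeroMean
    rw [integral_sub hp₁.integrable hp₂.integrable]
    have e₁ := hz₁ t ht
    have e₂ := hz₂ t ht
    unfold FunctionSpaces.Torus.HasZeroMean at e₁ e₂
    rw [e₁, e₂, sub_zero]
  funext x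
  exact sub_eq_zero.1 (eq_zero_of_gradient_eq_zero_of_hasZeroMean (hp₁.sub hp₂) hgrad hmean x)

end Unique

/-! ## The `H⁴` weight of the Fourier coefficients from the `C^{4,r}` norm -/

section Weight

variable {r : ℝ≥0} {k : ℕ}

/-- `‖Δg‖_{C^{k,r}} ≤ d · ‖g‖_{C^{k+2,r}}` for smooth `g` on `T^d` (`Δg = ∑ᵢ ∂ᵢ∂ᵢg` and
`‖∂ᵢf‖_{C^{k,r}} ≤ ‖f‖_{C^{k+1,r}}`). [folklore] -/
theorem eContDiffHolderNorm_laplacian_le {F : Type*} [NormedAddCommGroup F] [NormedSpace ℝ F]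
    {g : UnitAddTorus d → F} (hg : FunctionSpaces.Torus.IsSmooth g) (k : ℕ) (r : ℝ≥0) :
    FunctionSpaces.Torus.eContDiffHolderNorm k r (FunctionSpaces.Torus.laplacian g) ≤
      Fintype.card d * FunctionSpaces.Torus.eContDiffHolderNorm (k + 2) r g := by
  have hfun : FunctionSpaces.Torus.laplacian g =
      ∑ i, FunctionSpaces.Torus.partialDeriv i (FunctionSpaces.Torus.partialDeriv i g) := by
    funext x
    rw [FunctionSpaces.Torus.laplacian_eq_sum_partialDeriv_partialDeriv hg x, Finset.sum_apply]
  rw [hfun]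
  have hterm : ∀ i : d, FunctionSpaces.Torus.eContDiffHolderNorm k r
      (FunctionSpaces.Torus.partialDeriv i (FunctionSpaces.Torus.partialDeriv i g)) ≤
      FunctionSpaces.Torus.eContDiffHolderNorm (k + 2) r g := by
    intro i
    have h1 : FunctionSpaces.Torus.IsContDiff (k + 1 : ℕ) (FunctionSpaces.Torus.partialDeriv i g) :=
      (hg.partialDeriv i).isContDiff (mod_cast le_top)
    have h2 : FunctionSpaces.Torus.IsContDiff (k + 1 + 1 : ℕ) g := hg.isContDiff (mod_cast le_top)
    exact (FunctionSpaces.Torus.eContDiffHolderNorm_partialDeriv_le h1 i r).trans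
      (FunctionSpaces.Torus.eContDiffHolderNorm_partialDeriv_le h2 i r)
  calc FunctionSpaces.Torus.eContDiffHolderNorm k r
        (∑ i, FunctionSpaces.Torus.partialDeriv i (FunctionSpaces.Torus.partialDeriv i g))
      ≤ ∑ i, FunctionSpaces.Torus.eContDiffHolderNorm k r
          (FunctionSpaces.Torus.partialDeriv i (FunctionSpaces.Torus.partialDeriv i g)) :=
        FunctionSpaces.Torus.eContDiffHolderNorm_sum_le _ fun i _ =>
          ((hg.partialDeriv i).partialDeriv i).isContDiff (mod_cast le_top)
    _ ≤ ∑ _i : d, FunctionSpaces.Torus.eContDiffHolderNorm (k + 2) r g := Finset.sum_le_sum fun i _ => hterm i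
    _ = Fintype.card d * FunctionSpaces.Torus.eContDiffHolderNorm (k + 2) r g := by
        rw [Finset.sum_const, Finset.card_univ, nsmul_eq_mul]

/-- `‖g - cΔg‖_{C^{k,r}} ≤ (9 + |c| d) ‖g‖_{C^{k+2,r}}` for smooth `g` on `T^d` and `r ≤ 1`
(`‖g‖_{C^{k,r}} ≤ 3‖g‖_{C^{k+1,r}} ≤ 9‖g‖_{C^{k+2,r}}`). [folklore] -/
theorem eContDiffHolderNorm_sub_smul_laplacian_le {F : Type*} [NormedAddCommGroup F] [NormedSpace ℝ F]
    {g : UnitAddTorus d → F} (hg : FunctionSpaces.Torus.IsSmooth g) (c : ℝ) (k : ℕ) (hr : r ≤ 1) :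
    FunctionSpaces.Torus.eContDiffHolderNorm k r (fun x => g x - c • FunctionSpaces.Torus.laplacian g x) ≤
      (9 + ‖c‖ₑ * Fintype.card d) * FunctionSpaces.Torus.eContDiffHolderNorm (k + 2) r g := by
  have hfun : (fun x => g x - c • FunctionSpaces.Torus.laplacian g x) =
      g - c • FunctionSpaces.Torus.laplacian g := rfl
  rw [hfun]
  have hgk : FunctionSpaces.Torus.IsContDiff k g := hg.isContDiff (mod_cast le_top)
  have hgk1 : FunctionSpaces.Torus.IsContDiff (k + 1 : ℕ) g := hg.isContDiff (mod_cast le_top)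
  have hgk2 : FunctionSpaces.Torus.IsContDiff (k + 1 + 1 : ℕ) g := hg.isContDiff (mod_cast le_top)
  have hLk : FunctionSpaces.Torus.IsContDiff k (FunctionSpaces.Torus.laplacian g) :=
    hg.laplacian.isContDiff (mod_cast le_top)
  have hcL : FunctionSpaces.Torus.IsContDiff k (c • FunctionSpaces.Torus.laplacian g) := by
    unfold FunctionSpaces.Torus.IsContDiff at hLk ⊢
    exact hLk.const_smul c
  have h9 : FunctionSpaces.Torus.eContDiffHolderNorm k r g ≤ 9 * FunctionSpaces.Torus.eContDiffHolderNorm (k + 2) r g :=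
    calc FunctionSpaces.Torus.eContDiffHolderNorm k r g
        ≤ 3 * FunctionSpaces.Torus.eContDiffHolderNorm (k + 1) r g :=
          FunctionSpaces.Torus.eContDiffHolderNorm_le_three_mul_succ hgk1 hr r
      _ ≤ 3 * (3 * FunctionSpaces.Torus.eContDiffHolderNorm (k + 1 + 1) r g) := by
          gcongr
          exact FunctionSpaces.Torus.eContDiffHolderNorm_le_three_mul_succ hgk2 hr r
      _ = 9 * FunctionSpaces.Torus.eContDiffHolderNorm (k + 2) r g := by
          rw [← mul_assoc]; norm_num
  calc FunctionSpaces.Torus.eContDiffHolderNorm k r (g - c • FunctionSpaces.Torus.laplacian g)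
      ≤ FunctionSpaces.Torus.eContDiffHolderNorm k r g +
          FunctionSpaces.Torus.eContDiffHolderNorm k r (c • FunctionSpaces.Torus.laplacian g) :=
        FunctionSpaces.Torus.eContDiffHolderNorm_sub_le hgk hcL
    _ = FunctionSpaces.Torus.eContDiffHolderNorm k r g +
          ‖c‖ₑ * FunctionSpaces.Torus.eContDiffHolderNorm k r (FunctionSpaces.Torus.laplacian g) := by
        rw [FunctionSpaces.Torus.eContDiffHolderNorm_const_smul hLk]
    _ ≤ 9 * FunctionSpaces.Torus.eContDiffHolderNorm (k + 2) r g +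
          ‖c‖ₑ * (Fintype.card d * FunctionSpaces.Torus.eContDiffHolderNorm (k + 2) r g) := by
        gcongr
        exact eContDiffHolderNorm_laplacian_le hg k r
    _ = (9 + ‖c‖ₑ * Fintype.card d) * FunctionSpaces.Torus.eContDiffHolderNorm (k + 2) r g := by ring

/-- **The `H⁴` weight of the Fourier coefficients is controlled by the `C^{4,r}` norm**: for a
smooth real vector field `a` on `T^d`, `r ≤ 1` and `‖a‖_{C^{4,r}} ≤ B`,
`∑_{k ∈ S} (1 + |k|²)⁴ ‖â(k)‖² ≤ (C_d B)²` for every finite `S`, `C_d = (9 + d/4π²)²`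
(Parseval/Bessel for `A = (1 - Δ/4π²)²a`, whose coefficients are `(1+|k|²)² â(k)`
(`mFourierCoeff_complexify_iterate_oneSubLaplacian`), and `‖A‖_∞ ≤ C_d ‖a‖_{C^{4,r}}`).
[folklore] -/
theorem sum_weight_four_sq_norm_mFourierCoeff_le {a : UnitAddTorus d → EuclideanSpace ℝ d}
    (ha : FunctionSpaces.Torus.IsSmooth a) (hr : r ≤ 1) {B : ℝ} (hB : 0 ≤ B)
    (haB : FunctionSpaces.Torus.eContDiffHolderNorm 4 r a ≤ ENNReal.ofReal B) (S : Finset (d → ℤ)) :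
    ∑ k ∈ S, (1 + FunctionSpaces.Torus.freqNormSq k) ^ 4 *
        ‖UnitAddTorus.mFourierCoeff (FunctionSpaces.EuclideanSpace.complexify ∘ a) k‖ ^ 2 ≤
      ((9 + (4 * Real.pi ^ 2)⁻¹ * Fintype.card d) ^ 2 * B) ^ 2 := by
  classical
  -- the elliptic iterate `A = (1 - Δ/4π²)² a`
  set op : (UnitAddTorus d → EuclideanSpace ℝ d) → UnitAddTorus d → EuclideanSpace ℝ d :=
    fun b x => b x - (4 * Real.pi ^ 2)⁻¹ • FunctionSpaces.Torus.laplacian b x with hop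
  set A : UnitAddTorus d → EuclideanSpace ℝ d := op^[2] a with hA_def
  have hopa : FunctionSpaces.Torus.IsSmooth (op a) := ha.sub (ha.laplacian.smul _)
  have hA : FunctionSpaces.Torus.IsSmooth A := FunctionSpaces.Torus.isSmooth_iterate_oneSubLaplacian ha 2
  set Cd : ℝ := 9 + (4 * Real.pi ^ 2)⁻¹ * Fintype.card d with hCd
  have hCd0 : 0 ≤ Cd := by rw [hCd]; positivity
  -- `‖A‖_{C^{0,r}} ≤ C_d² B`
  have hc_enorm : ‖(4 * Real.pi ^ 2)⁻¹‖ₑ * (Fintype.card d : ℝ≥0∞) =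
      ENNReal.ofReal ((4 * Real.pi ^ 2)⁻¹ * Fintype.card d) := by
    rw [ENNReal.ofReal_mul (by positivity), ENNReal.ofReal_natCast, Real.enorm_eq_ofReal (by positivity)]
  have hCd_e : (9 : ℝ≥0∞) + ‖(4 * Real.pi ^ 2)⁻¹‖ₑ * (Fintype.card d : ℝ≥0∞) = ENNReal.ofReal Cd := by
    rw [hc_enorm, hCd, ENNReal.ofReal_add (by norm_num) (by positivity)]
    norm_num
  have hA2 : FunctionSpaces.Torus.eContDiffHolderNorm 0 r A ≤ ENNReal.ofReal (Cd * (Cd * B)) := by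
    have e1 : A = op (op a) := by rw [hA_def, Function.iterate_succ_apply', Function.iterate_one]
    rw [e1]
    calc FunctionSpaces.Torus.eContDiffHolderNorm 0 r (op (op a))
        ≤ (9 + ‖(4 * Real.pi ^ 2)⁻¹‖ₑ * Fintype.card d) * FunctionSpaces.Torus.eContDiffHolderNorm (0 + 2) r (op a) :=
          eContDiffHolderNorm_sub_smul_laplacian_le hopa _ 0 hr
      _ ≤ (9 + ‖(4 * Real.pi ^ 2)⁻¹‖ₑ * Fintype.card d) *
            ((9 + ‖(4 * Real.pi ^ 2)⁻¹‖ₑ * Fintype.card d) * FunctionSpaces.Torus.eContDiffHolderNorm (2 + 2) r a) := by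
          gcongr
          exact eContDiffHolderNorm_sub_smul_laplacian_le ha _ 2 hr
      _ ≤ ENNReal.ofReal Cd * (ENNReal.ofReal Cd * ENNReal.ofReal B) := by
          rw [hCd_e]; gcongr
      _ = ENNReal.ofReal (Cd * (Cd * B)) := by
          rw [← ENNReal.ofReal_mul hCd0, ← ENNReal.ofReal_mul hCd0]
  -- hence the pointwise bound
  have hApt : ∀ x, ‖A x‖ ≤ Cd * (Cd * B) := by
    intro x
    have h := (FunctionSpaces.Torus.enorm_le_eContDiffHolderNorm 0 r A x).trans hA2
    rwa [← ofReal_norm, ENNReal.ofReal_le_ofReal_iff (by positivity)] at h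
  -- Bessel for `A`
  have hcoef : ∀ k, (1 + FunctionSpaces.Torus.freqNormSq k) ^ 4 *
      ‖UnitAddTorus.mFourierCoeff (FunctionSpaces.EuclideanSpace.complexify ∘ a) k‖ ^ 2 =
      ‖UnitAddTorus.mFourierCoeff (FunctionSpaces.EuclideanSpace.complexify ∘ A) k‖ ^ 2 := by
    intro k
    have hk0 : 0 ≤ 1 + FunctionSpaces.Torus.freqNormSq k := by
      linarith [FunctionSpaces.Torus.freqNormSq_nonneg k]
    rw [hA_def, FunctionSpaces.Torus.mFourierCoeff_complexify_iterate_oneSubLaplacian ha 2 k, norm_smul,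
      Complex.norm_real, Real.norm_of_nonneg (pow_nonneg hk0 2)]
    ring
  simp_rw [hcoef]
  calc ∑ k ∈ S, ‖UnitAddTorus.mFourierCoeff (FunctionSpaces.EuclideanSpace.complexify ∘ A) k‖ ^ 2
      ≤ ∫ x, ‖A x‖ ^ 2 :=
        sum_le_hasSum S (fun _ _ => sq_nonneg _) (FunctionSpaces.Torus.hasSum_sq_norm_mFourierCoeff_complexify (hA.memLp 2))
    _ ≤ ∫ _x : UnitAddTorus d, (Cd * (Cd * B)) ^ 2 := by
        refine integral_mono ((hA.continuous.norm.pow 2).integrable_unitAddTorus) (integrable_const _)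
          fun x => ?_
        have h0 : 0 ≤ ‖A x‖ := norm_nonneg _
        exact pow_le_pow_left₀ h0 (hApt x) 2
    _ = (Cd ^ 2 * B) ^ 2 := by simp; ring

end Weight

/-! ## The continuation argument (forward restarts) -/

section Continuation

variable {θ ν T h : ℝ} {u₀ : UnitAddTorus d → EuclideanSpace ℝ d}
  {P : (UnitAddTorus d → EuclideanSpace ℝ d) → Prop}

omit [DecidableEq d] in
/-- `(· - c)⁻¹' [0, h] = [c, c + h]`. [folklore] -/
theorem preimage_sub_Icc_zero (c h : ℝ) :
    (fun s : ℝ => s - c) ⁻¹' Icc 0 h = Icc c (c + h) := by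
  ext s
  simp only [mem_preimage, mem_Icc]
  constructor <;> rintro ⟨h1, h2⟩ <;> constructor <;> linarith

/-- **One forward continuation step.** Given a short-time existence statement for data
satisfying `P` (a solution on `[0, h]` with zero-mean pressure), a solution `(u, p)` of the
fractional Navier–Stokes equations (`θ ≥ 0`, `ν ≥ 0`, zero stress) on `[0, b] × T^d`, `0 < b`,
with zero-mean pressure and all of whose slices satisfy `P`, there is a solution on
`[0, b + h/2]` with the same value at time `0` and zero-mean pressure: restart from
`u(s₀)`, `s₀ = max 0 (b - h/2)`, translate the local solution to `[s₀, s₀ + h] ⊇ [s₀, b + h/2]`,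
identify it with `u` on `[s₀, b]` by forward uniqueness, and glue. [folklore] -/
theorem IsFracNSReynoldsOn.step_forward
    (hloc : ∀ v₀ : UnitAddTorus d → EuclideanSpace ℝ d, FunctionSpaces.Torus.IsSmooth v₀ →
      FunctionSpaces.Torus.IsDivFree v₀ → P v₀ →
        ∃ (w : ℝ → UnitAddTorus d → EuclideanSpace ℝ d) (π : ℝ → UnitAddTorus d → ℝ),
          IsFracNSReynoldsOn (Icc 0 h) θ ν w π (fun _ _ _ => 0) ∧ w 0 = v₀ ∧
            ∀ t ∈ Icc 0 h, FunctionSpaces.Torus.HasZeroMean (π t))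
    (hθ : 0 ≤ θ) (hν : 0 ≤ ν) (hh : 0 < h) {b : ℝ} (hb : 0 < b)
    {u : ℝ → UnitAddTorus d → EuclideanSpace ℝ d} {p : ℝ → UnitAddTorus d → ℝ}
    (hu : IsFracNSReynoldsOn (Icc 0 b) θ ν u p (fun _ _ _ => 0))
    (hp : ∀ t ∈ Icc 0 b, FunctionSpaces.Torus.HasZeroMean (p t)) (hP : ∀ t ∈ Icc 0 b, P (u t)) :
    ∃ (u' : ℝ → UnitAddTorus d → EuclideanSpace ℝ d) (p' : ℝ → UnitAddTorus d → ℝ),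
      IsFracNSReynoldsOn (Icc 0 (b + h / 2)) θ ν u' p' (fun _ _ _ => 0) ∧ u' 0 = u 0 ∧
        ∀ t ∈ Icc 0 (b + h / 2), FunctionSpaces.Torus.HasZeroMean (p' t) := by
  -- the restart time `s₀ = max 0 (b - h/2)`
  set s₀ : ℝ := max 0 (b - h / 2) with hs₀
  have hs₀0 : 0 ≤ s₀ := le_max_left _ _
  have hs₀b : s₀ < b := max_lt hb (by linarith)
  have hs₀mem : s₀ ∈ Icc 0 b := ⟨hs₀0, hs₀b.le⟩
  have hbs₀ : b + h / 2 ≤ s₀ + h := by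
    have : b - h / 2 ≤ s₀ := le_max_right _ _
    linarith
  obtain ⟨w, π, hw, hw0, hπ⟩ := hloc (u s₀) (hu.smooth_velocity.isSmooth_slice hs₀mem)
    (hu.divFree s₀ hs₀mem) (hP s₀ hs₀mem)
  -- translate the local solution to `[s₀, s₀ + h]`
  have hw' : IsFracNSReynoldsOn (Icc s₀ (s₀ + h)) θ ν (fun t => w (t - s₀)) (fun t => π (t - s₀))
      (fun _ _ _ => 0) := by
    have h := hw.translate s₀
    rw [preimage_sub_Icc_zero] at h
    exact h
  -- identification on the overlap `[s₀, b]`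
  have hu_ov : IsFracNSReynoldsOn (Icc s₀ b) θ ν u p (fun _ _ _ => 0) :=
    hu.mono (Icc_subset_Icc hs₀0 le_rfl) (uniqueDiffOn_Icc hs₀b)
  have hw_ov : IsFracNSReynoldsOn (Icc s₀ b) θ ν (fun t => w (t - s₀)) (fun t => π (t - s₀)) (fun _ _ _ => 0) :=
    hw'.mono (Icc_subset_Icc le_rfl (by linarith)) (uniqueDiffOn_Icc hs₀b)
  have hw_b' : IsFracNSReynoldsOn (Icc s₀ (b + h / 2)) θ ν (fun t => w (t - s₀)) (fun t => π (t - s₀))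
      (fun _ _ _ => 0) :=
    hw'.mono (Icc_subset_Icc le_rfl hbs₀) (uniqueDiffOn_Icc (by linarith))
  have hπ' : ∀ t ∈ Icc s₀ (s₀ + h), FunctionSpaces.Torus.HasZeroMean (π (t - s₀)) := fun t ht =>
    hπ (t - s₀) ⟨by linarith [ht.1], by linarith [ht.2]⟩
  have heq : ∀ t ∈ Icc s₀ b, u t = (fun t => w (t - s₀)) t ∧ p t = (fun t => π (t - s₀)) t := fun t ht =>
    hu_ov.unique_forward hw_ov hθ hν hs₀b (by simp [hw0]) (fun s hs => hp s ⟨hs₀0.trans hs.1, hs.2⟩)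
      (fun s hs => hπ' s ⟨hs.1, hs.2.trans (by linarith)⟩) ht
  -- glue at the midpoint of the overlap
  set m : ℝ := (s₀ + b) / 2 with hm
  have hs₀m : s₀ < m := by rw [hm]; linarith
  have hmb : m < b := by rw [hm]; linarith
  have h0m : (0 : ℝ) ≤ m := hs₀0.trans hs₀m.le
  refine ⟨_, _, hu.glue hw_b' hs₀0 hs₀m hmb (by linarith) heq, by simp only [if_pos h0m], ?_⟩
  intro t ht
  by_cases htm : t ≤ m
  · simp only [if_pos htm]
    exact hp t ⟨ht.1, htm.trans hmb.le⟩
  · simp only [if_neg htm]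
    exact hπ' t ⟨(hs₀m.trans (not_le.1 htm)).le, ht.2.trans hbs₀⟩

/-- **Forward continuation to the endpoint.** If data satisfying `P` launch solutions on
`[0, h]` (with zero-mean pressure) and every solution on `[0, b] × T^d`, `0 < b ≤ T`, with
`u(0) = u₀` and zero-mean pressure has all its slices satisfying `P`, then a solution on
`[0, b₀]` (`0 < b₀ ≤ T`) through `u₀` with zero-mean pressure extends to
`[0, min (b₀ + n h/2) T]` for every `n`, keeping `u(0) = u₀` and the zero-mean pressure.
[folklore] -/
theorem IsFracNSReynoldsOn.extend_forward
    (hloc : ∀ v₀ : UnitAddTorus d → EuclideanSpace ℝ d, FunctionSpaces.Torus.IsSmooth v₀ →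
      FunctionSpaces.Torus.IsDivFree v₀ → P v₀ →
        ∃ (w : ℝ → UnitAddTorus d → EuclideanSpace ℝ d) (π : ℝ → UnitAddTorus d → ℝ),
          IsFracNSReynoldsOn (Icc 0 h) θ ν w π (fun _ _ _ => 0) ∧ w 0 = v₀ ∧
            ∀ t ∈ Icc 0 h, FunctionSpaces.Torus.HasZeroMean (π t))
    (hbound : ∀ (b : ℝ) (u : ℝ → UnitAddTorus d → EuclideanSpace ℝ d) (p : ℝ → UnitAddTorus d → ℝ),
      0 < b → b ≤ T → IsFracNSReynoldsOn (Icc 0 b) θ ν u p (fun _ _ _ => 0) → u 0 = u₀ →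
        ∀ t ∈ Icc 0 b, P (u t))
    (hθ : 0 ≤ θ) (hν : 0 ≤ ν) (hh : 0 < h) {b₀ : ℝ} (hb₀ : 0 < b₀) (hb₀T : b₀ ≤ T)
    {u : ℝ → UnitAddTorus d → EuclideanSpace ℝ d} {p : ℝ → UnitAddTorus d → ℝ}
    (hu : IsFracNSReynoldsOn (Icc 0 b₀) θ ν u p (fun _ _ _ => 0)) (hu0 : u 0 = u₀)
    (hp : ∀ t ∈ Icc 0 b₀, FunctionSpaces.Torus.HasZeroMean (p t)) (n : ℕ) :
    ∃ (u' : ℝ → UnitAddTorus d → EuclideanSpace ℝ d) (p' : ℝ → UnitAddTorus d → ℝ),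
      IsFracNSReynoldsOn (Icc 0 (min (b₀ + n * (h / 2)) T)) θ ν u' p' (fun _ _ _ => 0) ∧ u' 0 = u₀ ∧
        ∀ t ∈ Icc 0 (min (b₀ + n * (h / 2)) T), FunctionSpaces.Torus.HasZeroMean (p' t) := by
  induction n with
  | zero =>
    refine ⟨u, p, ?_, hu0, ?_⟩
    · simp only [Nat.cast_zero, zero_mul, add_zero, min_eq_left hb₀T]
      exact hu
    · simp only [Nat.cast_zero, zero_mul, add_zero, min_eq_left hb₀T]
      exact hp
  | succ n ih =>
    obtain ⟨v, q, hv, hv0, hq⟩ := ih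
    set b : ℝ := min (b₀ + n * (h / 2)) T with hb_def
    by_cases hbT : b₀ + n * (h / 2) < T
    · have hb_eq : b = b₀ + n * (h / 2) := min_eq_left hbT.le
      have hb_pos : 0 < b := by rw [hb_eq]; positivity
      have hPb : ∀ t ∈ Icc 0 b, P (v t) := hbound b v q hb_pos (min_le_right _ _) hv hv0
      obtain ⟨u', p', hu', hu'0, hp'⟩ := IsFracNSReynoldsOn.step_forward hloc hθ hν hh hb_pos hv hq hPb
      have hsub : Icc 0 (min (b₀ + (↑(n + 1) : ℝ) * (h / 2)) T) ⊆ Icc 0 (b + h / 2) := by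
        refine Icc_subset_Icc le_rfl ((min_le_left _ _).trans (le_of_eq ?_))
        rw [hb_eq]; push_cast; ring
      have hpos : 0 < min (b₀ + (↑(n + 1) : ℝ) * (h / 2)) T := lt_min (by positivity) (hb₀.trans_le hb₀T)
      exact ⟨u', p', hu'.mono hsub (uniqueDiffOn_Icc hpos), hu'0.trans hv0, fun t ht => hp' t (hsub ht)⟩
    · -- already at `T`
      have hb_eq : b = T := min_eq_right (not_lt.1 hbT)
      have hset : min (b₀ + (↑(n + 1) : ℝ) * (h / 2)) T = T := by
        refine min_eq_right ((not_lt.1 hbT).trans ?_)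
        push_cast
        nlinarith
      refine ⟨v, q, ?_, hv0, ?_⟩
      · rw [hset, ← hb_eq]; exact hv
      · rw [hset, ← hb_eq]; exact hq

end Continuation

end Torus

end Literature.Analysis.FluidPDE
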